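import Summits.ABC.IUTFork.Thm311RealInd2Ism
import HarnessLib

/-!
# [IUTchIII] Theorem 3.11 (i) (Ind2), print-literal at `𝕍^non`: NON-VACUITY — every `û ∈ Ẑ^×` acts, through the GALOIS
# `p`-adic logarithm, as the SCALAR `χ_p(û) ∈ ℤ_p^×` on `K_v`, and this scalar IS in print's (Ind2)-group

Record file (D-0012) of the abc-iut cell (seat abc-iut-c312-1, holder of record of the typed [IUTchIII] Thm. 3.11,
gen 7); sequel of `Thm311RealInd2Ism.lean`; TAKES NO SIDE on [IUTchIII] Cor. 3.12.

[IUTchII] Example 1.8 (iv) (kurims p. 39): "another example of such a `Γ^{×μ}` is the image `Im(Ẑ^×)` of the natural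
homomorphism `Ẑ^× ↠ ℤ_p^× ↪ Ism`".  abc-iut-L6-d2 PROVED (`Genuine.zhatOxmu_mem_isometryGroup`, p427597) that every
`û ∈ Ẑ^×` acts on the genuine `O^{×μ}(G_v)` by a `G_v`-ISOMETRY (`x ↦ x^{χ_p(û)}`), with `log_k̄(û·x) = χ_p(û)·log_k̄ x`
(`Genuine.toAdd_log_zhatOxmu`).  Read on the real log-shell this says: the scalar `χ_p(û) ∈ ℤ_p^× ⊆ K_v` REALISES a print
isometry.  With the sibling upper bound (`Thm311RealInd2IsmScalar`: every element of print's (Ind2) is an integer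
scalar modulo every `n` on the log-lattice) this pins print's (Ind2) on `log_v(𝒪_v^×)` between the `Ẑ^×`-scalars
(dense in `ℤ_p^×`) and the maps that are scalars modulo every `n`.

TYPED: `Real.galoisLog v` — the GALOIS `p_v`-adic logarithm `𝒪_v^× → K_v`: abc-iut-L6-d2's real `log_k̄ : k~ ⥲ K̄_v`
(`MLFClosure.galoisPadicLog`, [AbsTopIII] Def. 3.1 (i)) restricted to `𝒪_v^×`, whose values are `G_v`-fixed hence lie in
`K_v` (a `PadicLogs`-type datum at `v`; its agreement with c312-5's analytic `Real.analyticLogv` is the classical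
uniqueness of the `p`-adic logarithm — abc-iut-L6-d2's `GaloisPadicLogUniqueness`, not re-derived here);
`Real.padicUnitScalar v û ∈ K_v` — the scalar `χ_p(û)`.
PROVED: `Real.algebraMap_galoisLog` (defining property), `Real.padicUnitScalar_ne_zero`,
`Real.realises_zhatOxmu_mulLeft` (multiplication by `χ_p(û)` realises L6-d2's isometry `zhatOxmu û` through `galoisLog`),
**`Real.mulLeft_padicUnitScalar_mem_ismIsmOf`** — `(x ↦ χ_p(û)·x) ∈ Real.ismIsmOf v (galoisLog v)` for EVERY `û ∈ Ẑ^×`: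
print's (Ind2) at `v` contains all `Ẑ^×`-scalars (non-vacuity far beyond `±1`).

HONEST SCOPE: about OUR typed objects; `galoisLog` is ONE logarithm binder (the Galois-theoretic one); nothing here
asserts or refutes [IUTchIII] Cor. 3.12; no side taken. [claim: Mochizuki2012, status: disputed] for the quotations;
[cite: MochizukiAbsTopIII2015, Definition 3.1 (i) p.66]. typed ≠ proved; instantiated ≠ endorsed.
-/

set_option autoImplicit false

noncomputable section

namespace Summit.ABC.IUTFork.Thm311.Real

open NumberField IsDedekindDomain Literature.IUT.LogVolume Literature.IUT.LogThetaLattice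
open Literature.AnabelianGeometry.AbsoluteAnabelian Literature.IUT.HodgeArakelov
open Literature.IUT.HodgeArakelov.AbsTopMonoids Literature.AnabelianGeometry.EtaleTheta

variable {F : Type} [Field F] [NumberField F] (v : HeightOneSpectrum (𝓞 F))

/-! ## 1. The Galois `p_v`-adic logarithm on `𝒪_v^×`, read in `K_v` -/

/-- `log_k̄(u)` for `u ∈ 𝒪_v^×` is fixed by `G_v`, hence equals `algebraMap K_v K̄_v a` for a unique `a ∈ K_v`.
[cite: MochizukiAbsTopIII2015, Definition 3.1 (i) p.66] -/
theorem exists_algebraMap_eq_log (u : (↥(v.adicCompletionIntegers F))ˣ) :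
    ∃ a : v.adicCompletion F, algebraMap (v.adicCompletion F) (AlgebraicClosure (v.adicCompletion F)) a =
      (closureAt v).galoisPadicLog.log (algebraMap (v.adicCompletion F) (AlgebraicClosure (v.adicCompletion F))
        ((u : ↥(v.adicCompletionIntegers F)) : v.adicCompletion F)) := by
  haveI := Literature.NumberTheory.GaloisRepresentations.charZero_adicCompletion v
  haveI : IsGalois (v.adicCompletion F) (AlgebraicClosure (v.adicCompletion F)) := {}
  set x := algebraMap (v.adicCompletion F) (AlgebraicClosure (v.adicCompletion F))
    ((u : ↥(v.adicCompletionIntegers F)) : v.adicCompletion F) with hx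
  have hxu : x ∈ unitSubmonoid (v.adicCompletion F) (AlgebraicClosure (v.adicCompletion F)) :=
    (algebraMap_mem_invariantUnits (v.adicCompletion F) (AlgebraicClosure (v.adicCompletion F))
      (valuation_coe_unit v u)).1
  have hfix : ∀ σ : Gal v, σ ((closureAt v).galoisPadicLog.log x) = (closureAt v).galoisPadicLog.log x := by
    intro σ
    have h := (closureAt v).galoisPadicLog.log_smul σ x hxu
    rw [AlgEquiv.smul_def, AlgEquiv.smul_def, show σ x = x from σ.commutes _] at h
    exact h.symm
  have hmem : (closureAt v).galoisPadicLog.log x ∈ (⊥ : IntermediateField (v.adicCompletion F)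
      (AlgebraicClosure (v.adicCompletion F))) := by
    rw [InfiniteGalois.mem_bot_iff_fixed]
    intro σ
    simpa [AlgEquiv.smul_def] using hfix σ
  obtain ⟨a, ha⟩ := IntermediateField.mem_bot.mp hmem
  exact ⟨a, ha⟩

/-- The Galois logarithm of a unit, as an element of `K_v` (choice of the unique preimage). [cite: MochizukiAbsTopIII2015, Definition 3.1 (i) p.66] -/
def galoisLogFun (u : (↥(v.adicCompletionIntegers F))ˣ) : v.adicCompletion F := (exists_algebraMap_eq_log v u).choose

/-- Defining property of `galoisLogFun`. [cite: MochizukiAbsTopIII2015, Definition 3.1 (i) p.66] -/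
theorem algebraMap_galoisLogFun (u : (↥(v.adicCompletionIntegers F))ˣ) :
    algebraMap (v.adicCompletion F) (AlgebraicClosure (v.adicCompletion F)) (galoisLogFun v u) =
      (closureAt v).galoisPadicLog.log (algebraMap (v.adicCompletion F) (AlgebraicClosure (v.adicCompletion F))
        ((u : ↥(v.adicCompletionIntegers F)) : v.adicCompletion F)) :=
  (exists_algebraMap_eq_log v u).choose_spec

/-- `log 1 = 0`. [cite: MochizukiAbsTopIII2015, Definition 3.1 (i) p.66] -/
theorem galoisLogFun_one : galoisLogFun v (1 : (↥(v.adicCompletionIntegers F))ˣ) = 0 := by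
  apply (algebraMap (v.adicCompletion F) (AlgebraicClosure (v.adicCompletion F))).injective
  rw [algebraMap_galoisLogFun, map_zero, Units.val_one, OneMemClass.coe_one, map_one]
  exact ((closureAt v).galoisPadicLog.log_eq_zero_iff 1 (unitSubmonoid _ _).one_mem).mpr ⟨1, one_pos, one_pow 1⟩

/-- `log (ab) = log a + log b` on units. [cite: MochizukiAbsTopIII2015, Definition 3.1 (i) p.66] -/
theorem galoisLogFun_mul (a b : (↥(v.adicCompletionIntegers F))ˣ) :
    galoisLogFun v (a * b) = galoisLogFun v a + galoisLogFun v b := by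
  apply (algebraMap (v.adicCompletion F) (AlgebraicClosure (v.adicCompletion F))).injective
  rw [map_add, algebraMap_galoisLogFun, algebraMap_galoisLogFun, algebraMap_galoisLogFun, Units.val_mul,
    MulMemClass.coe_mul, map_mul]
  exact (closureAt v).galoisPadicLog.log_mul _
    (algebraMap_mem_invariantUnits _ _ (valuation_coe_unit v a)).1 _
    (algebraMap_mem_invariantUnits _ _ (valuation_coe_unit v b)).1

/-- **The GALOIS `p_v`-adic logarithm on `𝒪_v^×`**: `u ↦` the element of `K_v` mapping to `log_k̄(u)` under
`K_v → K̄_v` (abc-iut-L6-d2's real `log_k̄` of [AbsTopIII] Def. 3.1 (i), restricted to the `G_v`-invariants).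
[cite: MochizukiAbsTopIII2015, Definition 3.1 (i) p.66] -/
def galoisLog : Additive (↥(v.adicCompletionIntegers F))ˣ →+ v.adicCompletion F where
  toFun u := galoisLogFun v (Additive.toMul u)
  map_zero' := galoisLogFun_one v
  map_add' a b := galoisLogFun_mul v (Additive.toMul a) (Additive.toMul b)

/-- Defining property: `algebraMap K_v K̄_v (galoisLog v u) = log_k̄ (algebraMap u)`. [cite: MochizukiAbsTopIII2015, Definition 3.1 (i) p.66] -/
theorem algebraMap_galoisLog (u : (↥(v.adicCompletionIntegers F))ˣ) :
    algebraMap (v.adicCompletion F) (AlgebraicClosure (v.adicCompletion F)) (galoisLog v (Additive.ofMul u)) =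
      (closureAt v).galoisPadicLog.log (algebraMap (v.adicCompletion F) (AlgebraicClosure (v.adicCompletion F))
        ((u : ↥(v.adicCompletionIntegers F)) : v.adicCompletion F)) :=
  algebraMap_galoisLogFun v u

/-- `log_k̄` of the class `[u] ∈ O^{×μ}(G_v)` (through abc-iut-L6-d2's bridge `oxmuBridge`) is `galoisLog v u`, read in `K̄_v`.
[cite: MochizukiAbsTopIII2015, Definition 3.1 (i) p.66] -/
theorem toAdd_logEquiv_oxmuBridge_clsOf (u : (↥(v.adicCompletionIntegers F))ˣ) :
    Multiplicative.toAdd ((closureAt v).logEquiv (Genuine.oxmuBridge (closureAt v) (clsOf v u))) =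
      algebraMap (v.adicCompletion F) (AlgebraicClosure (v.adicCompletion F)) (galoisLog v (Additive.ofMul u)) := by
  rw [clsOf, Genuine.oxmuBridge_mk, MulEquiv.apply_symm_apply, MLFClosure.logEquiv_mk, toAdd_ofAdd,
    algebraMap_galoisLog]
  rfl

/-! ## 2. `Ẑ^×`-scalars realise print isometries -/

section ZHat

/-! The residue characteristic `p_v` of `K_v` is prime (`(closureAt v).fact_residueChar_prime`); as in abc-iut-L6-d2's files
it is carried as a `Fact` binder, discharged by that theorem at use sites. -/
variable [Fact (closureAt v).residueChar.Prime]

/-- **The scalar `χ_p(û) ∈ K_v`** of `û ∈ Ẑ^×`: the `p_v`-adic cyclotomic character (the tree's `ZHatLevel.padicChar`)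
followed by `ℤ_p → ℚ_p → K_v` (the tree's `LocalField.padicRingHom`), i.e. abc-iut-L6-d2's `MLFClosure.padicScalar` before
the final `K_v → K̄_v`. [claim: Mochizuki2012, status: disputed] -/
def padicUnitScalar (û : ZHatUnits) : v.adicCompletion F :=
  haveI : CharZero (v.adicCompletion F) := Literature.NumberTheory.GaloisRepresentations.charZero_adicCompletion v
  ((Literature.NumberTheory.GaloisRepresentations.LocalField.padicRingHom (v.adicCompletion F) (closureAt v).residueChar
      (closureAt v).valuation_ringChar_lt_one).comp PadicInt.Coe.ringHom) (ZHatLevel.padicChar (closureAt v).residueChar û)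

/-- `C.padicScalar (χ_p û) = algebraMap K_v K̄_v (padicUnitScalar v û)` (abc-iut-L6-d2's `padicScalar`, unfolded).
[claim: Mochizuki2012, status: disputed] -/
theorem padicScalar_padicChar (û : ZHatUnits) :
    (closureAt v).padicScalar (ZHatLevel.padicChar (closureAt v).residueChar û) =
      algebraMap (v.adicCompletion F) (AlgebraicClosure (v.adicCompletion F)) (padicUnitScalar v û) :=
  rfl

/-- `χ_p(û) ≠ 0` in `K_v` (`χ_p(û)` is a unit of `ℤ_p`; `ℚ_p → K_v` is injective). [claim: Mochizuki2012, status: disputed] -/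
theorem padicUnitScalar_ne_zero (û : ZHatUnits) : padicUnitScalar v û ≠ 0 := by
  haveI : CharZero (v.adicCompletion F) := Literature.NumberTheory.GaloisRepresentations.charZero_adicCompletion v
  intro h
  change Literature.NumberTheory.GaloisRepresentations.LocalField.padicRingHom (v.adicCompletion F)
      (closureAt v).residueChar (closureAt v).valuation_ringChar_lt_one
      ((ZHatLevel.padicChar (closureAt v).residueChar û : ℤ_[(closureAt v).residueChar]) :
        ℚ_[(closureAt v).residueChar]) = 0 at h
  rw [map_eq_zero_iff _ (RingHom.injective _)] at h
  exact (ZHatLevel.isUnit_padicChar (closureAt v).residueChar û).ne_zero (PadicInt.coe_eq_zero.mp h)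

/-- Multiplication by `χ_p(û)` on `K_v`, as an additive automorphism. [folklore] -/
def mulPadicUnitScalar (û : ZHatUnits) : v.adicCompletion F ≃+ v.adicCompletion F :=
  AddAut.mulLeft (Units.mk0 (padicUnitScalar v û) (padicUnitScalar_ne_zero v û))

/-- `mulPadicUnitScalar v û x = χ_p(û) · x`. [folklore] -/
@[simp] theorem mulPadicUnitScalar_apply (û : ZHatUnits) (x : v.adicCompletion F) :
    mulPadicUnitScalar v û x = padicUnitScalar v û * x := rfl

/-- abc-iut-L6-d2's isometry `zhatOxmu û` (`x ↦ x^{χ_p(û)}` on `O^{×μ}(G_v)`) lies in PRINT's `Ism(G_v)` as typed here (the two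
Galois-type actions coincide: `galRho v = Genuine.unitsActionOf (closureAt v) id`). [claim: Mochizuki2012, status: disputed] -/
theorem zhatOxmu_mem_ismGenuine (û : ZHatUnits) : Genuine.zhatOxmu (closureAt v) û ∈ ismGenuine v :=
  Genuine.zhatOxmu_mem_isometryGroup (closureAt v) (MonoidHom.id (Gal v)) (openSubgroups v) û

/-- **Multiplication by `χ_p(û)` REALISES the isometry `zhatOxmu û` through the Galois logarithm**:
`[u]^{χ_p(û)} = [u'] ⟹ χ_p(û) · log u = log u'` (abc-iut-L6-d2's `toAdd_log_zhatOxmu`: `log_k̄(û·x) = χ_p(û)·log_k̄ x`).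
[claim: Mochizuki2012, status: disputed] -/
theorem realises_zhatOxmu_mulLeft (û : ZHatUnits) :
    Realises v (galoisLog v) (Genuine.zhatOxmu (closureAt v) û) (mulPadicUnitScalar v û) := by
  intro u u' h
  apply (algebraMap (v.adicCompletion F) (AlgebraicClosure (v.adicCompletion F))).injective
  rw [mulPadicUnitScalar_apply, map_mul, ← padicScalar_padicChar, ← toAdd_logEquiv_oxmuBridge_clsOf,
    ← toAdd_logEquiv_oxmuBridge_clsOf, ← h, Genuine.toAdd_log_zhatOxmu]

/-- **NON-VACUITY OF PRINT'S (Ind2), `Ẑ^×` form**: for EVERY `û ∈ Ẑ^×`, multiplication by the `p_v`-adic unit scalar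
`χ_p(û)` on `K_v` lies in print's (Ind2)-group `Real.ismIsmOf v (galoisLog v)` — [IUTchII] Ex. 1.8 (iv)'s
"`Ẑ^× ↠ ℤ_p^× ↪ Ism`" read on the real log-shell through the Galois logarithm. [claim: Mochizuki2012, status: disputed] -/
theorem mulPadicUnitScalar_mem_ismIsmOf (û : ZHatUnits) : mulPadicUnitScalar v û ∈ ismIsmOf v (galoisLog v) := by
  refine ⟨?_, ?_, Genuine.zhatOxmu (closureAt v) û, zhatOxmu_mem_ismGenuine v û, realises_zhatOxmu_mulLeft v û⟩
  · exact continuous_const.mul continuous_id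
  · change Continuous (fun x => (mulPadicUnitScalar v û).symm x)
    have : ∀ x, (mulPadicUnitScalar v û).symm x = (padicUnitScalar v û)⁻¹ * x := fun x => by
      apply (mulPadicUnitScalar v û).injective
      rw [AddEquiv.apply_symm_apply, mulPadicUnitScalar_apply, ← mul_assoc,
        mul_inv_cancel₀ (padicUnitScalar_ne_zero v û), one_mul]
    simp_rw [this]
    exact continuous_const.mul continuous_id

end ZHat

end Summit.ABC.IUTFork.Thm311.Real

end
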